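import Literature.Analysis.FunctionSpaces.TorusClassicalNSExhaustion
import HarnessLib

/-!
# Classical Navier–Stokes solutions on the flat torus: restart-and-glue from a HALF-OPEN first window

Function-space support file (all results proved; no definitions, no named facts) for the accepted notion
`Torus.IsClassicalNSSolutionOn S ν f u p` of `TorusFluidGlue`, continuing `TorusClassicalNSPerturbedRestart`
(`glue_restart`: restart a classical solution on `[a, b]` from its own slice at `s ∈ [a, b)` and glue) and
`TorusClassicalNSExhaustion` (`of_local_inter`: locality in time on an arbitrary time set).  Strong solutions
issued from NON-SMOOTH (`V`-valued) data are classical only for POSITIVE times, i.e. on the half-open window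
`(c, b]` (Robinson–Rodrigo–Sadowski 2016, Thm 6.8 with Thm 7.5); continuing them by restarts from their (smooth)
slices produces classical solutions on closed windows `[s, b']`, `c < s`.  This file supplies the bookkeeping
that glues the two:

* `Torus.IsClassicalNSSolutionOn.glue_restart_Ioc` — `(u₁, p₁)` classical on `Ioc c b`, `(u₂, p₂)` classical on
  `Icc s b'`, `c < s < b ≤ b'`, `u₂ s = u₁ s` ⟹ a classical solution `(u, p)` on `Ioc c b'` with `u = u₁` on
  `(c, s]` and every slice equal to `u₁ t` (some `t ∈ (c, b]`) or to `u₂ t` (some `t ∈ [s, b']`): the velocities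
  agree on `[s, b]` by forward uniqueness (`velocity_unique`), the pressures normalised at a base point agree on
  `(s, b)` (`pressure_sub_eq_of_eventuallyEq`), and the pair switching at the midpoint of `[s, b]` is classical on
  `Ioc c b'` by locality (`of_local_inter` with the charts `Iio b` and `Ioi s`).

Tree search (`lean search 'glue_restart|glue_Ioo|glue_Ioi|glue_Icc|of_local_inter'`): gluing for two closed windows
(`glue_Icc`, `glue_restart`), two open windows (`glue_Ioo`, `glue_Ioi`), locality (`of_local`, `of_local_inter`);
nothing for a half-open first window.  Mathlib: `uniqueDiffOn_Ioc/Ioo/Icc`, `Ioo_mem_nhds`, `Icc_mem_nhds`.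

## References

* J. C. Robinson, J. L. Rodrigo, W. Sadowski, *The Three-Dimensional Navier–Stokes Equations.
  Classical Theory*, CUP 2016, Thm 6.8, Thm 7.5, §8.1 (restart, identify on the overlap, continue).
  [RobinsonRodrigoSadowskiCUP2016]
* A. J. Majda, A. L. Bertozzi, *Vorticity and Incompressible Flow*, CUP 2002, §3.2.3, Cor. 3.1.
  [MajdaBertozziCUP2002]
-/

open MeasureTheory Set Filter
open _root_.Topology
open scoped InnerProductSpace ContDiff

noncomputable section

namespace Literature.Analysis.FunctionSpaces

namespace Torus

variable {d : Type*} [Fintype d] [DecidableEq d]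

variable {ν : ℝ} {f : ℝ → UnitAddTorus d → EuclideanSpace ℝ d}

/-- **Restart and glue from a half-open first window.**  Let `(u₁, p₁)` solve NS_ν(f), `ν ≥ 0`, classically on
`(c, b] × T^d` and `(u₂, p₂)` on `[s, b'] × T^d`, where `c < s < b ≤ b'` and `u₂(s) = u₁(s)` (the second solution
is restarted from the slice of the first at time `s`).  Then there is a classical solution `(u, p)` of NS_ν(f) on
`(c, b'] × T^d` with `u = u₁` on `(c, s]` and every slice `u(t)` equal to `u₁(t)` (some `t ∈ (c, b]`) or to `u₂(t)`
(some `t ∈ [s, b']`): the velocities agree on `[s, b]` by forward uniqueness (`velocity_unique`), the pressures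
normalised at a base point agree on `(s, b)` (`pressure_sub_eq_of_eventuallyEq`), and the pair that switches at
the midpoint `m` of `[s, b]` is classical on `(c, b']` by locality in time (`of_local_inter`): near `t < b` it agrees
with `(u₁, p₁ − p₁(·, x₀))` on `(c, b)`, near `t ≥ b` with `(u₂, p₂ − p₂(·, x₀))` on `(s, b']`
(Robinson–Rodrigo–Sadowski 2016, §8.1, for solutions that are classical only for positive times, Thm 6.8 with
Thm 7.5). [folklore] -/
theorem IsClassicalNSSolutionOn.glue_restart_Ioc (hν : 0 ≤ ν) {c b s b' : ℝ}
    {u₁ u₂ : ℝ → UnitAddTorus d → EuclideanSpace ℝ d} {p₁ p₂ : ℝ → UnitAddTorus d → ℝ}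
    (h₁ : IsClassicalNSSolutionOn (Ioc c b) ν f u₁ p₁) (h₂ : IsClassicalNSSolutionOn (Icc s b') ν f u₂ p₂)
    (hcs : c < s) (hsb : s < b) (hbb' : b ≤ b') (h0 : u₂ s = u₁ s) :
    ∃ (u : ℝ → UnitAddTorus d → EuclideanSpace ℝ d) (p : ℝ → UnitAddTorus d → ℝ),
      IsClassicalNSSolutionOn (Ioc c b') ν f u p ∧ (∀ t ∈ Ioc c s, u t = u₁ t) ∧
        ∀ t ∈ Ioc c b', (t ∈ Ioc c b ∧ u t = u₁ t) ∨ (t ∈ Icc s b' ∧ u t = u₂ t) := by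
  set x₀ : UnitAddTorus d := 0
  -- identification of the velocities on the closed overlap `[s, b]`
  have hsub₁ : Icc s b ⊆ Ioc c b := fun t ht => ⟨hcs.trans_le ht.1, ht.2⟩
  have hsub₂ : Icc s b ⊆ Icc s b' := Icc_subset_Icc le_rfl hbb'
  have hov : ∀ t ∈ Icc s b, u₁ t = u₂ t := fun t ht =>
    (h₁.mono hsub₁ (uniqueDiffOn_Icc hsb)).velocity_unique hν (h₂.mono hsub₂ (uniqueDiffOn_Icc hsb))
      h0.symm ht
  -- the normalised pressures agree on the open overlap `(s, b)`
  have hpr : ∀ t ∈ Ioo s b, (fun x => p₁ t x - p₁ t x₀) = fun x => p₂ t x - p₂ t x₀ := by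
    intro t ht
    funext x
    exact h₁.pressure_sub_eq_of_eventuallyEq h₂
      (mem_of_superset (Ioo_mem_nhds (hcs.trans ht.1) ht.2) Ioo_subset_Ioc_self)
      (Icc_mem_nhds ht.1 (ht.2.trans_le hbb'))
      (by filter_upwards [Ioo_mem_nhds ht.1 ht.2] with τ hτ using hov τ (Ioo_subset_Icc_self hτ)) x x₀
  -- switch at the midpoint of `[s, b]`
  set m : ℝ := (s + b) / 2 with hm
  have hsm : s < m := by rw [hm]; linarith
  have hmb : m < b := by rw [hm]; linarith
  refine ⟨fun t => if t ≤ m then u₁ t else u₂ t,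
    fun t => if t ≤ m then (fun x => p₁ t x - p₁ t x₀) else fun x => p₂ t x - p₂ t x₀, ?_,
    fun t ht => ?_, fun t ht => ?_⟩
  · refine IsClassicalNSSolutionOn.of_local_inter fun t ht => ?_
    by_cases htb : t < b
    · -- the chart `(u₁, p₁ − p₁(·, x₀))` on `Ioc c b' ∩ Iio b = Ioo c b`
      have hS : Ioc c b' ∩ Iio b = Ioo c b := by
        ext τ
        simp only [mem_inter_iff, mem_Ioc, mem_Iio, mem_Ioo]
        constructor
        · rintro ⟨⟨h1, -⟩, h2⟩
          exact ⟨h1, h2⟩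
        · rintro ⟨h1, h2⟩
          exact ⟨⟨h1, h2.le.trans hbb'⟩, h2⟩
      refine ⟨Iio b, isOpen_Iio, htb, u₁, fun τ x => p₁ τ x - p₁ τ x₀, ?_, fun τ hτ => ?_, fun τ hτ => ?_⟩
      · rw [hS]
        exact (h₁.mono Ioo_subset_Ioc_self (uniqueDiffOn_Ioo c b)).sub_pressure_apply x₀
      · rw [hS] at hτ
        by_cases hτm : τ ≤ m
        · simp only [if_pos hτm]
        · simp only [if_neg hτm]
          exact hov τ ⟨(hsm.trans (not_le.1 hτm)).le, hτ.2.le⟩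
      · rw [hS] at hτ
        by_cases hτm : τ ≤ m
        · simp only [if_pos hτm]
        · simp only [if_neg hτm]
          exact hpr τ ⟨hsm.trans (not_le.1 hτm), hτ.2⟩
    · -- the chart `(u₂, p₂ − p₂(·, x₀))` on `Ioc c b' ∩ Ioi s = Ioc s b'`
      have hbt : b ≤ t := not_lt.1 htb
      have hS : Ioc c b' ∩ Ioi s = Ioc s b' := by
        ext τ
        simp only [mem_inter_iff, mem_Ioc, mem_Ioi]
        constructor
        · rintro ⟨⟨-, h1⟩, h2⟩
          exact ⟨h2, h1⟩
        · rintro ⟨h1, h2⟩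
          exact ⟨⟨hcs.trans h1, h2⟩, h1⟩
      refine ⟨Ioi s, isOpen_Ioi, hsb.trans_le hbt, u₂, fun τ x => p₂ τ x - p₂ τ x₀, ?_, fun τ hτ => ?_,
        fun τ hτ => ?_⟩
      · rw [hS]
        exact (h₂.mono Ioc_subset_Icc_self (uniqueDiffOn_Ioc s b')).sub_pressure_apply x₀
      · rw [hS] at hτ
        by_cases hτm : τ ≤ m
        · simp only [if_pos hτm]
          exact (hov τ ⟨hτ.1.le, hτm.trans hmb.le⟩).symm
        · simp only [if_neg hτm]
      · rw [hS] at hτ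
        by_cases hτm : τ ≤ m
        · simp only [if_pos hτm]
          exact (hpr τ ⟨hτ.1, hτm.trans_lt hmb⟩).symm
        · simp only [if_neg hτm]
  · simp only [if_pos (ht.2.trans hsm.le)]
  · by_cases htm : t ≤ m
    · exact Or.inl ⟨⟨ht.1, htm.trans hmb.le⟩, by simp only [if_pos htm]⟩
    · exact Or.inr ⟨⟨(hsm.trans (not_le.1 htm)).le, ht.2⟩, by simp only [if_neg htm]⟩

end Torus

end Literature.Analysis.FunctionSpaces

end
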